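import Summits.BirchSwinnertonDyer.BirchSwinnertonDyer.Theorems.KolyvaginDepthDoorKolyvaginDepthSupplyZhangGrossPow
import Summits.BirchSwinnertonDyer.BirchSwinnertonDyer.Theorems.CMKolyvaginAtInertTwoConjugationTypeAtTwo
import Summits.BirchSwinnertonDyer.BirchSwinnertonDyer.Theorems.GenusKolyvaginAtTwoGenusPrimitiveSupplyAtTwoConjugationTypeAtTwo
import Summits.BirchSwinnertonDyer.BirchSwinnertonDyer.Theorems.GenusKolyvaginAtTwoPowDvdShaCardAtTwoRTNonPhantomPowAtMultiplicative
import Literature.NumberTheory.EllipticCurves.GoodReductionUnramifiedProofs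
import HarnessLib

/-!
# Route `GenusKolyvaginAtTwo`, LINE 18 (L_T `PowDvdShaCardAtTwoRT`, stmt-BirchSwinnertonDyer-23242): at `p = 2`,
# GROSS–KOLYVAGIN PRIMES OF ZHANG INDEX `≥ M` ARE LEVEL-`2^M` GROSS PRIMES (`Δ < 0`, `ρ_{E,2^M}` onto)

Seat `bsd-line-gk2-p5` g22 (cell `bsd-f1-sign2`, SUPPLY lineage), `--supports stmt-BirchSwinnertonDyer-23242` (helper; it
closes nothing and BSD is not proved by it).

WHY (LEAD gk2-p1 memo `Cruxes/PowDvdShaCardAtTwoRT/Lines/plus-descent-lead-g17.md` §6, «(β″)-precise»).  The bottom-rung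
engine of LINE 18 asks at the witness primes `FrobEqFrobInfty W K (2^2) ℓ` (hypothesis `ht4` of `…RTBottomRungEngine*`) on top
of `FrobEqFrobInfty W K 2 ℓ ∧ 2 ≤ Zhang2014.kolyvaginIndex W 2 ℓ ∧ Zhang2014.IsKolyvaginPrime …` (`hTK`).  At ODD `p` Zhang's
congruences of index `≥ M` give Gross's condition modulo `p^M` under surjectivity (`KolyvaginDepthDoor.frobEqFrobInfty_pow_of_zhang`,
eigen-lines); at `p = 2` they do NOT (an involution of `E[4]` with characteristic polynomial `x² − 1` may be `≡ 1 (mod 2)`), and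
eigen-lines coincide modulo `2`.  THIS FILE proves the level-lifting at `2` from the classical LEVEL-2 condition (Gross (3.2) at
`p = 2`, `FrobEqFrobInfty W K 2 ℓ`, contained in the tree's `IsKolyvaginPrime … 2 ℓ`) on `Δ < 0`:

* `exists_addEquiv_conj_of_involutions` — on `T ≅ (ℤ/2^{n+1})²` (`2^{n+1} T = 0`, `#T = 4^{n+1}`, `T[2] ≤ 2^n T`) two
  involutions EACH MOVING A `2`-TORSION POINT are conjugate under `Aut T`: for such `ι` and `Q ∈ T[2]` with `ι Q ≠ Q`,
  `2^n P₂ = Q`, `P₁ := ι P₂ − P₂` give a basis with `ι P₁ = −P₁`, `ι P₂ = P₁ + P₂` (`exists_swapPair_of_involution`), i.e. the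
  matrix `(−1 1; 0 1)` for EVERY such `ι`.
* `frobEqFrobInfty_two_pow_of_frobEqFrobInfty_two` — `W/ℚ` globally minimal, `Δ(W) < 0`, `K` imaginary quadratic, `ℓ` a
  Zhang–Kolyvagin prime at `2`, `M ≤ kolyvaginIndex W 2 ℓ` (`M ≥ 1`), `FrobEqFrobInfty W K 2 ℓ`, `ρ_{E,2^M}` onto ⟹
  `FrobEqFrobInfty W K (2^M) ℓ`.  A Frobenius `h₀` above `ℓ` is an involution of `E[2^M]`
  (`KolyvaginDepthDoor.frob_smul_smul_eq_self_of_pow_dvd`) moving a point of `E[2]` (transport of the level-2 hypothesis along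
  the `Gal(ℚ̄/ℚ)`-conjugacy of the primes above `ℓ`, inertia trivial on `E[2]`); a complex conjugation `c₀` is an involution
  moving a point of `E[2]` (`Δ < 0`); §1 conjugates them by `ρ_{E,2^M}(g)`, `h = g h₀ g⁻¹` is a Frobenius above `ℓ` acting as
  `c₀` on `E[2^M]`, and on `K` both are the non-trivial automorphism (`ℓ` inert) — the last steps verbatim as at odd `p`.
* §3: frame forms — from Gross's `IsKolyvaginPrime N_E W K 2 ℓ` and the tower `∀ n ≥ 1, ρ_{E,2^n}` onto; Gross's predicate
  at level `2^M`; and `frobEqFrobInfty_four_of_frobEqFrobInfty_two` = the engine's `ht4` from its `hTK`.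

So the two (β″) re-typings of `hPn` — «`IsKolyvaginPrime … 2 ℓ ∧ 2 ≤ kolyvaginIndex W 2 ℓ`» (classical) and
«`Zhang2014.IsKolyvaginPrime … ∧ 2 ≤ kolyvaginIndex … ∧ FrobEqFrobInfty W K (2^2) ℓ`» — are interchangeable on the habitat;
bare Zhang primes with `Frob_ℓ ≡ 1` on `E[2]` stay excluded (there the lifting is false, LEAD §6).  BSD is not proved by this.

References: [GrossLMS1991] §3 (3.1)–(3.3); [McCallumLMS1991] §4 (p. 299), §5 Lemma 5.3; [WZhang2014] Notations (xii);
[SilvermanAEC2009] III.6.4(b), VII.4.1(a).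
-/

set_option linter.dupNamespace false
set_option autoImplicit false

noncomputable section

open scoped Classical Pointwise

/-! ## §1 Linear algebra: two involutions of `(ℤ/2^{n+1})²` moving a `2`-torsion point are conjugate -/

namespace Summit.BirchSwinnertonDyer.BirchSwinnertonDyer.Theorems.GenusExact.GrossLevelAtTwo

open Summit.BirchSwinnertonDyer.BirchSwinnertonDyer.Theorems.GenusExact.NonPhantomPow
  (dvd_of_zsmul_eq_zero_of_order zsmul_eq_zero_of_dvd)

section LinearAlgebra

variable {T : Type*} [AddCommGroup T]

/-- **Coordinates.** If `2^{n+1} T = 0`, `#T = 4^{n+1}` and `P₁, P₂ ∈ T` are `ℤ/2^{n+1}`-independent, then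
`(a, b) ↦ a P₁ + b P₂` is an isomorphism `ℤ/2^{n+1} × ℤ/2^{n+1} ≃ T` (injective, bijective by counting). [folklore] -/
theorem exists_coordEquiv_of_indep (n : ℕ) (hTN : ∀ t : T, ((2 : ℤ) ^ (n + 1)) • t = 0)
    (hcard : Nat.card T = (2 ^ (n + 1)) ^ 2) {P₁ P₂ : T}
    (hindep : ∀ a b : ℤ, a • P₁ + b • P₂ = 0 → (2 : ℤ) ^ (n + 1) ∣ a ∧ (2 : ℤ) ^ (n + 1) ∣ b) :
    ∃ e : ZMod (2 ^ (n + 1)) × ZMod (2 ^ (n + 1)) ≃+ T,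
      ∀ a b : ℤ, e ((a : ZMod (2 ^ (n + 1))), (b : ZMod (2 ^ (n + 1)))) = a • P₁ + b • P₂ := by
  set q : ℤ := (2 : ℤ) ^ (n + 1) with hq
  have hn : ((2 ^ (n + 1) : ℕ) : ℤ) = q := by rw [hq]; norm_cast
  have h4P₁ : (zmultiplesHom T P₁) ((2 ^ (n + 1) : ℕ) : ℤ) = 0 := by rw [zmultiplesHom_apply, hn]; exact hTN P₁
  have h4P₂ : (zmultiplesHom T P₂) ((2 ^ (n + 1) : ℕ) : ℤ) = 0 := by rw [zmultiplesHom_apply, hn]; exact hTN P₂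
  obtain ⟨f, hf⟩ : ∃ f : ZMod (2 ^ (n + 1)) × ZMod (2 ^ (n + 1)) →+ T,
      f = (ZMod.lift (2 ^ (n + 1)) ⟨zmultiplesHom T P₁, h4P₁⟩).coprod
        (ZMod.lift (2 ^ (n + 1)) ⟨zmultiplesHom T P₂, h4P₂⟩) := ⟨_, rfl⟩
  have hfapp : ∀ a b : ℤ, f ((a : ZMod (2 ^ (n + 1))), (b : ZMod (2 ^ (n + 1)))) = a • P₁ + b • P₂ := by
    intro a b
    rw [hf, AddMonoidHom.coprod_apply, ZMod.lift_coe, ZMod.lift_coe]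
    rfl
  haveI : NeZero (2 ^ (n + 1)) := ⟨pow_ne_zero _ two_ne_zero⟩
  have hfinj : Function.Injective f := by
    rw [injective_iff_map_eq_zero]
    rintro ⟨x, y⟩ hxy
    rw [← ZMod.intCast_zmod_cast x, ← ZMod.intCast_zmod_cast y, hfapp] at hxy
    obtain ⟨hx, hy⟩ := hindep _ _ hxy
    rw [Prod.mk_eq_zero, ← ZMod.intCast_zmod_cast x, ← ZMod.intCast_zmod_cast y,
      ZMod.intCast_zmod_eq_zero_iff_dvd, ZMod.intCast_zmod_eq_zero_iff_dvd]
    exact ⟨by rw [hn]; exact hx, by rw [hn]; exact hy⟩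
  haveI : Finite T := Nat.finite_of_card_ne_zero (by rw [hcard]; positivity)
  have hfbij : Function.Bijective f :=
    hfinj.bijective_of_nat_card_le (by rw [hcard, Nat.card_prod, Nat.card_zmod, sq])
  exact ⟨AddEquiv.ofBijective f hfbij, fun a b ↦ hfapp a b⟩

/-- **The swap pair of an involution moving a `2`-torsion point.** `2^{n+1} T = 0`, `T[2] ≤ 2^n T`, `ι` an involution of
`T`, `Q ∈ T[2]` with `ι Q ≠ Q`: with `2^n P₂ = Q` and `P₁ := ι P₂ − P₂` one has `ι P₁ = −P₁`, `ι P₂ = P₁ + P₂`, and `P₁, P₂`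
are `ℤ/2^{n+1}`-independent. [folklore] -/
theorem exists_swapPair_of_involution (n : ℕ) (hTN : ∀ t : T, ((2 : ℤ) ^ (n + 1)) • t = 0)
    (hdiv : ∀ t : T, (2 : ℤ) • t = 0 → ∃ y : T, t = ((2 : ℤ) ^ n) • y)
    (ι : T →+ T) (hι : ∀ t, ι (ι t) = t) {Q : T} (h2Q : (2 : ℤ) • Q = 0) (hιQ : ι Q ≠ Q) :
    ∃ P₁ P₂ : T, ι P₁ = -P₁ ∧ ι P₂ = P₁ + P₂ ∧
      ∀ a b : ℤ, a • P₁ + b • P₂ = 0 → (2 : ℤ) ^ (n + 1) ∣ a ∧ (2 : ℤ) ^ (n + 1) ∣ b := by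
  set q : ℤ := (2 : ℤ) ^ (n + 1) with hq
  obtain ⟨P₂, hP₂⟩ := hdiv Q h2Q
  set P₁ : T := ι P₂ - P₂ with hP₁
  have hιP₁ : ι P₁ = -P₁ := by rw [hP₁, map_sub, hι, neg_sub]
  have hιP₂ : ι P₂ = P₁ + P₂ := by rw [hP₁, sub_add_cancel]
  -- `2^n P₁ = ι Q − Q ≠ 0`, so `P₁` and `P₁ + 2 P₂` have order `2^{n+1}`
  have hhalfP₁ : ((2 : ℤ) ^ n) • P₁ ≠ 0 := by
    rw [hP₁, smul_sub, ← map_zsmul, ← hP₂, sub_ne_zero]; exact hιQ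
  have hhalf' : ((2 : ℤ) ^ n) • (P₁ + (2 : ℤ) • P₂) ≠ 0 := by
    rwa [smul_add, smul_smul, ← pow_succ, hTN P₂, add_zero]
  have hsucc : n + 1 - 1 = n := by omega
  refine ⟨P₁, P₂, hιP₁, hιP₂, fun a b hab ↦ ?_⟩
  -- apply `ι`: `(b − a) P₁ + b P₂ = 0`, hence `(2a − b) P₁ = 0`
  have hab' : (b - a) • P₁ + b • P₂ = 0 := by
    have h := congrArg ι hab
    rw [map_add, map_zsmul, map_zsmul, hιP₁, hιP₂, map_zero, smul_neg, smul_add] at h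
    rw [← h]; module
  have h2ab : (2 * a - b) • P₁ = 0 := by
    have : (2 * a - b) • P₁ = (a • P₁ + b • P₂) - ((b - a) • P₁ + b • P₂) := by module
    rw [this, hab, hab', sub_zero]
  have hdvd₁ : q ∣ 2 * a - b := dvd_of_zsmul_eq_zero_of_order (L := n + 1) (hTN P₁) (by rwa [hsucc]) h2ab
  -- so `a (P₁ + 2 P₂) = 0`
  have haP : a • (P₁ + (2 : ℤ) • P₂) = 0 := by
    obtain ⟨k, hk⟩ := hdvd₁
    have hb : b = 2 * a - q * k := by rw [← hk]; ring
    have : a • (P₁ + (2 : ℤ) • P₂) = a • P₁ + b • P₂ + k • (q • P₂) := by rw [hb]; module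
    rw [this, hab, hTN P₂, smul_zero, add_zero]
  have hqP : q • (P₁ + (2 : ℤ) • P₂) = 0 := hTN _
  have hdvda : q ∣ a := dvd_of_zsmul_eq_zero_of_order (L := n + 1) hqP (by rwa [hsucc]) haP
  refine ⟨hdvda, ?_⟩
  have : b = 2 * a - (2 * a - b) := by ring
  rw [this]
  exact dvd_sub (dvd_mul_of_dvd_right hdvda 2) hdvd₁

/-- **Two involutions of `T ≅ (ℤ/2^{n+1})²`, each moving a `2`-torsion point, are conjugate under `Aut T`**: in their swap
pairs both act by `(−1 1; 0 1)`, so the base change `Φ : P_i ↦ R_i` has `Φ ∘ ι₁ = ι₂ ∘ Φ`. [folklore] [cite: McCallumLMS1991, §5 Lemma 5.3] -/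
theorem exists_addEquiv_conj_of_involutions (n : ℕ) (hTN : ∀ t : T, ((2 : ℤ) ^ (n + 1)) • t = 0)
    (hcard : Nat.card T = (2 ^ (n + 1)) ^ 2)
    (hdiv : ∀ t : T, (2 : ℤ) • t = 0 → ∃ y : T, t = ((2 : ℤ) ^ n) • y)
    (ι₁ ι₂ : T →+ T) (hι₁ : ∀ t, ι₁ (ι₁ t) = t) (hι₂ : ∀ t, ι₂ (ι₂ t) = t)
    (hQ₁ : ∃ Q : T, (2 : ℤ) • Q = 0 ∧ ι₁ Q ≠ Q) (hQ₂ : ∃ Q : T, (2 : ℤ) • Q = 0 ∧ ι₂ Q ≠ Q) :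
    ∃ Φ : T ≃+ T, ∀ t, Φ (ι₁ t) = ι₂ (Φ t) := by
  obtain ⟨Q₁, h2Q₁, hQ₁⟩ := hQ₁
  obtain ⟨Q₂, h2Q₂, hQ₂⟩ := hQ₂
  obtain ⟨P₁, P₂, hιP₁, hιP₂, hindP⟩ := exists_swapPair_of_involution n hTN hdiv ι₁ hι₁ h2Q₁ hQ₁
  obtain ⟨R₁, R₂, hιR₁, hιR₂, hindR⟩ := exists_swapPair_of_involution n hTN hdiv ι₂ hι₂ h2Q₂ hQ₂
  obtain ⟨e₁, he₁⟩ := exists_coordEquiv_of_indep n hTN hcard hindP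
  obtain ⟨e₂, he₂⟩ := exists_coordEquiv_of_indep n hTN hcard hindR
  refine ⟨e₁.symm.trans e₂, fun t ↦ ?_⟩
  -- write `t = a P₁ + b P₂`
  obtain ⟨⟨x, y⟩, rfl⟩ := e₁.surjective t
  rw [AddEquiv.trans_apply, AddEquiv.trans_apply, AddEquiv.symm_apply_apply,
    ← ZMod.intCast_zmod_cast x, ← ZMod.intCast_zmod_cast y, he₁, he₂]
  set a : ℤ := x.cast
  set b : ℤ := y.cast
  have h₁ : ι₁ (a • P₁ + b • P₂) = (b - a) • P₁ + b • P₂ := by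
    rw [map_add, map_zsmul, map_zsmul, hιP₁, hιP₂]; module
  have h₂ : ι₂ (a • R₁ + b • R₂) = (b - a) • R₁ + b • R₂ := by
    rw [map_add, map_zsmul, map_zsmul, hιR₁, hιR₂]; module
  rw [h₁, h₂, ← he₁ (b - a) b, AddEquiv.symm_apply_apply, he₂]

end LinearAlgebra
end Summit.BirchSwinnertonDyer.BirchSwinnertonDyer.Theorems.GenusExact.GrossLevelAtTwo

/-! ## §2 The level-lifting at `2` -/
namespace Summit.BirchSwinnertonDyer.BirchSwinnertonDyer.Theorems.GenusExact.GrossLevelAtTwo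

open WeierstrassCurve Field Function NumberField IsDedekindDomain Rat.HeightOneSpectrum
open Literature.NumberTheory.EllipticCurves Literature.NumberTheory.GaloisRepresentations Module
open Summit.BirchSwinnertonDyer.Rank1Residual.X11b.Three.Koly.Method2
open Summit.BirchSwinnertonDyer.Rank1Residual.X11b.Three.Koly.Method2.KolyLocal
open Summit.BirchSwinnertonDyer.BirchSwinnertonDyer.Theorems.KolyvaginDepthDoor (frob_smul_smul_eq_self_of_pow_dvd)
open Summit.BirchSwinnertonDyer.BirchSwinnertonDyer.Theorems.GenusExact.NonPhantomPow
  (pow_zsmul_geomTorsion_eq_zero exists_eq_pow_zsmul_of_two_zsmul_eq_zero)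

variable (W : WeierstrassCurve ℚ) [W.IsElliptic] [W.IsGloballyMinimal] (K : Type) [Field K] [NumberField K]

/-- **At `p = 2`: a Gross–Kolyvagin prime (`Frob(ℓ) = Frob(∞)` on `K(E[2])`) of Zhang index `≥ M` is a level-`2^M` Gross
prime** when `ρ_{E,2^M}` is onto and `Δ < 0` (`K` imaginary quadratic, `M ≥ 1`): `FrobEqFrobInfty W K (2^M) ℓ`.
Proof: module docstring (involutions moving a `2`-torsion point are conjugate; Galois bookkeeping as at odd `p`).
[cite: GrossLMS1991, §3 (3.2)–(3.3)] [cite: McCallumLMS1991, §4 (p. 299), §5 Lemma 5.3] [cite: WZhang2014, Notations (xii)] -/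
theorem frobEqFrobInfty_two_pow_of_frobEqFrobInfty_two (hK : IsImaginaryQuadratic K) (hΔ : W.Δ < 0) {M : ℕ}
    (hM : 1 ≤ M) (hsurjM : W.HasSurjectiveModNGaloisRep (2 ^ M : ℕ)) {ℓ : ℕ}
    (hℓ : Zhang2014.IsKolyvaginPrime (W.conductorNorm ℤ) W K 2 ℓ)
    (hℓM : M ≤ Zhang2014.kolyvaginIndex W 2 ℓ) (hG : FrobEqFrobInfty W K 2 ℓ) :
    FrobEqFrobInfty W K (2 ^ M) ℓ := by
  haveI : Fact (Nat.Prime 2) := ⟨Nat.prime_two⟩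
  obtain ⟨n, rfl⟩ : ∃ n, M = n + 1 := ⟨M - 1, by omega⟩
  haveI : Algebra.IsQuadraticExtension ℚ K := ⟨hK.1⟩
  haveI : IsTotallyComplex K := hK.2
  have hℓp : ℓ.Prime := hℓ.1
  haveI : Fact ℓ.Prime := ⟨hℓp⟩
  have hℓ3 : ℓ ≠ 2 := hℓ.2.2.2.1
  have hℓP : (Ideal.span {(ℓ : 𝓞 K)}).IsPrime := hℓ.2.2.2.2.1
  have hdvdM := (Zhang2014.le_kolyvaginIndex_iff (W := W) (p := 2)).mp hℓM
  set N : ℕ := 2 ^ (n + 1) with hN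
  haveI : NeZero N := ⟨pow_ne_zero _ two_ne_zero⟩
  -- ### places: `w = (ℓ)` in `K`, `v₁` below it in `ℚ`, a prime `𝔓 ∣ w` of `\bar ℤ_K`, `𝔓' = 𝔓 ∩ \bar ℤ`
  let w : HeightOneSpectrum (𝓞 K) := ⟨Ideal.span {(ℓ : 𝓞 K)}, hℓP, by
    rw [Ne, Ideal.span_singleton_eq_bot]; exact_mod_cast hℓp.ne_zero⟩
  have hw : (ℓ : 𝓞 K) ∈ w.asIdeal := Ideal.mem_span_singleton_self _
  set v₁ : HeightOneSpectrum (𝓞 ℚ) := w.under (𝓞 ℚ) with hv₁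
  have hwv₁ : w.asIdeal.under (𝓞 ℚ) = v₁.asIdeal := rfl
  have hℓv₁ : (ℓ : 𝓞 ℚ) ∈ v₁.asIdeal := by
    rw [← hwv₁, Ideal.under_def, Ideal.mem_comap, map_natCast]; exact hw
  have hv₁ℓ : (primesEquiv v₁ : ℕ) = ℓ := primesEquiv_eq_of_natCast_mem hℓp hℓv₁
  obtain ⟨𝔐, h𝔐⟩ := w.localPrimesAbove_nonempty
  set 𝔓 := w.primeBelow (closureEmb (K := K) (w.adicCompletion K)) 𝔐 with h𝔓def
  have h𝔓 : 𝔓 ∈ w.primesAbove := HeightOneSpectrum.primeBelow_mem_primesAbove h𝔐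
  set 𝔓' := 𝔓.comap (absIntegersMap ℚ K) with h𝔓'def
  have h𝔓' : 𝔓' ∈ v₁.primesAbove := comap_absIntegersMap_mem_primesAbove hwv₁ h𝔓
  have hgoodv : W.HasGoodReductionAt v₁ :=
    LocalFrob.hasGoodReductionAt_rat_of_not_dvd_conductorNorm W hℓp hℓ.2.1 v₁ hℓv₁
  have h2v : ((((2 : ℕ) : ℤ)) : 𝓞 ℚ) ∉ v₁.asIdeal := by
    intro h2
    rw [Int.cast_natCast] at h2
    exact hℓ3 (hv₁ℓ.symm.trans (primesEquiv_eq_of_natCast_mem Nat.prime_two h2))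
  -- ### the two involutions: a Frobenius `h₀` above `ℓ` and a complex conjugation `c₀`
  obtain ⟨h₀, hh₀⟩ := HeightOneSpectrum.exists_isArithFrobAt_of_mem_primesAbove_holds h𝔓'
  obtain ⟨c₀, hc₀⟩ := exists_isComplexConjugation (Rat.castHom ℝ)
  -- ### `T = E[2^{n+1}]`: killed by `2^{n+1}`, of order `4^{n+1}`, `T[2] ≤ 2^n T`
  set T := geomTorsion W ((N : ℕ) : ℤ) with hTdef
  have hNq : ((N : ℕ) : ℤ) = ((2 ^ (n + 1) : ℕ) : ℤ) := by rw [hN]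
  have hTN : ∀ t : T, ((2 : ℤ) ^ (n + 1)) • t = 0 := pow_zsmul_geomTorsion_eq_zero W hNq
  have hdiv : ∀ t : T, (2 : ℤ) • t = 0 → ∃ y : T, t = ((2 : ℤ) ^ n) • y := fun t ht ↦ by
    obtain ⟨y, hy⟩ := exists_eq_pow_zsmul_of_two_zsmul_eq_zero W (L := n + 1) (by omega) hNq t ht
    rw [Nat.add_sub_cancel] at hy
    exact ⟨y, hy⟩
  have hcardT : Nat.card T = (2 ^ (n + 1)) ^ 2 :=
    card_torsionPoints_eq_sq_holds W (AlgebraicClosure ℚ) (n := N) (by exact_mod_cast NeZero.ne N)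
  -- the inclusion `E[2] ⊆ E[2^{n+1}]`
  have hmemN : ∀ P : geomTorsion W ((2 : ℕ) : ℤ), (P : W.geomPoints) ∈ T := fun P ↦ by
    have hP := (mem_geomTorsion_iff W ((2 : ℕ) : ℤ) (P : W.geomPoints)).mp P.2
    have h2N : ((N : ℕ) : ℤ) = (2 : ℤ) ^ n * ((2 : ℕ) : ℤ) := by rw [hN]; push_cast; ring
    rw [hTdef, mem_geomTorsion_iff, h2N, mul_smul, hP, smul_zero]
  let incl : geomTorsion W ((2 : ℕ) : ℤ) → T := fun P ↦ ⟨P, hmemN P⟩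
  have hincl2 : ∀ P : geomTorsion W ((2 : ℕ) : ℤ), (2 : ℤ) • incl P = 0 := fun P ↦ by
    apply Subtype.ext
    have hP := (mem_geomTorsion_iff W ((2 : ℕ) : ℤ) (P : W.geomPoints)).mp P.2
    change (2 : ℤ) • (P : W.geomPoints) = 0
    exact_mod_cast hP
  have hincl_smul : ∀ (g : absoluteGaloisGroup ℚ) (P : geomTorsion W ((2 : ℕ) : ℤ)),
      g • incl P = incl (g • P) := fun g P ↦ Subtype.ext rfl
  have hincl_ne : ∀ {g : absoluteGaloisGroup ℚ} {P : geomTorsion W ((2 : ℕ) : ℤ)}, g • P ≠ P →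
      g • incl P ≠ incl P := fun {g} {P} hne heq ↦ by
    rw [hincl_smul] at heq
    exact hne (Subtype.ext (congrArg (fun x : T ↦ (x : W.geomPoints)) heq))
  -- ### `h₀` moves a point of `E[2]`: transport of the level-2 hypothesis
  have hQ₁ : ∃ Q : T, (2 : ℤ) • Q = 0 ∧ h₀ • Q ≠ Q := by
    obtain ⟨v', 𝔓'', h'', ⟨hv', h𝔓'', hfr''⟩, P, hP⟩ :=
      GenusKolySign.exists_twoTorsion_frob_smul_ne_of_frobEqFrobInfty_of_Δ_neg W hΔ hG
    -- the place above `ℓ` is unique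
    have hvv : v' = v₁ := by
      have h1 : (primesEquiv v' : ℕ) = ℓ := primesEquiv_eq_of_natCast_mem hℓp hv'
      exact primesEquiv.injective (Subtype.ext (h1.trans hv₁ℓ.symm))
    rw [hvv] at h𝔓''
    -- move `h₀` to `𝔓''` and compare with `h''` up to inertia (trivial on `E[2]`)
    obtain ⟨g, hg⟩ := HeightOneSpectrum.exists_smul_eq_of_mem_primesAbove_holds h𝔓' h𝔓''
    have hσ₁ : IsArithFrobAt (𝓞 ℚ) (g * h₀ * g⁻¹) 𝔓'' := hg ▸ hh₀.conj g
    have hI := hfr''.mul_inv_mem_inertia hσ₁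
    have hσσ₁ : ∀ P : geomTorsion W ((2 : ℕ) : ℤ), h'' • P = (g * h₀ * g⁻¹) • P := fun P ↦ by
      have h' := W.smul_geomTorsion_eq_of_mem_inertia hgoodv h2v h𝔓'' hI ((g * h₀ * g⁻¹) • P)
      rwa [mul_smul, inv_smul_smul] at h'
    have hP' : (g * h₀ * g⁻¹) • P ≠ P := by rw [← hσσ₁]; exact hP
    have hmove : h₀ • (g⁻¹ • P) ≠ g⁻¹ • P := by
      intro heq
      apply hP'
      rw [mul_smul, mul_smul, heq, smul_inv_smul]
    exact ⟨incl (g⁻¹ • P), hincl2 _, hincl_ne hmove⟩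
  -- ### `c₀` moves a point of `E[2]` (`Δ < 0`)
  have hQ₂ : ∃ Q : T, (2 : ℤ) • Q = 0 ∧ c₀ • Q ≠ Q := by
    obtain ⟨P, hP⟩ := KolyvaginEigenTwo.exists_twoTorsion_smul_ne_of_Δ_neg W hΔ hc₀
    exact ⟨incl P, hincl2 _, hincl_ne hP⟩
  -- ### both are involutions of `T`
  have haℓ : ((2 : ℤ) ^ (n + 1)) ∣ W.frobeniusTraceAt v₁ := by
    rw [frobeniusTraceAt_eq_frobeniusTrace W v₁, show ((primesEquiv v₁ : ℕ)) = ℓ from hv₁ℓ]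
    exact_mod_cast hdvdM.2
  have hA2N : ∀ P : T, h₀ • h₀ • P = P := fun P ↦ by
    apply Subtype.ext
    exact frob_smul_smul_eq_self_of_pow_dvd W n hℓp hℓ3 hℓv₁ hgoodv h𝔓' hh₀ hdvdM.1 haℓ P.2
  have hC2N : ∀ P : T, c₀ • c₀ • P = P := fun P ↦ by
    rw [← mul_smul, ← pow_two, hc₀.sq_eq_one, one_smul]
  let ι₁ : T →+ T := DistribSMul.toAddMonoidHom T h₀
  let ι₂ : T →+ T := DistribSMul.toAddMonoidHom T c₀
  have hι₁ : ∀ x, ι₁ x = h₀ • x := fun x ↦ rfl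
  have hι₂ : ∀ x, ι₂ x = c₀ • x := fun x ↦ rfl
  -- ### the conjugator `Φ` with `Φ ∘ h₀ = c₀ ∘ Φ`, realised by `g ∈ Γ_ℚ`
  obtain ⟨Φ, hΦ⟩ := exists_addEquiv_conj_of_involutions n hTN hcardT hdiv ι₁ ι₂
    (fun t ↦ by rw [hι₁, hι₁, hA2N]) (fun t ↦ by rw [hι₂, hι₂, hC2N])
    (by simpa only [hι₁] using hQ₁) (by simpa only [hι₂] using hQ₂)
  have hΦA : ∀ P : T, Φ (h₀ • P) = c₀ • Φ P := fun P ↦ by rw [← hι₁, ← hι₂, hΦ]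
  obtain ⟨g, hg⟩ := hsurjM (Multiplicative.ofAdd Φ)
  have hgP : ∀ P : T, g • P = Φ P := fun P ↦ by
    have := congrArg (fun φ ↦ (Multiplicative.toAdd φ) P) hg
    simpa using this
  set h := g * h₀ * g⁻¹ with hhdef
  have hhP : ∀ P : T, h • P = c₀ • P := fun P ↦ by
    have hg' : g⁻¹ • P = Φ.symm P := by
      rw [inv_smul_eq_iff, hgP, AddEquiv.apply_symm_apply]
    rw [hhdef, mul_smul, mul_smul, hg', hgP, hΦA, AddEquiv.apply_symm_apply]
  have hhFrob : IsArithFrobAt (𝓞 ℚ) h (g • 𝔓') := hh₀.conj g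
  -- ### on `K`: `h` and `c₀` both restrict to the non-trivial automorphism
  letI : Algebra K (AlgebraicClosure ℚ) := (absEmbedding ℚ K).toRingHom.toAlgebra
  haveI : IsScalarTower ℚ K (AlgebraicClosure ℚ) :=
    IsScalarTower.of_algebraMap_eq fun q ↦ ((absEmbedding ℚ K).commutes q).symm
  let r : absoluteGaloisGroup ℚ →* (K ≃ₐ[ℚ] K) :=
    (AlgEquiv.restrictNormalHom K).comp (absoluteGaloisGroup.toAlgEquiv ℚ).toMonoidHom
  have hr : ∀ (σ : absoluteGaloisGroup ℚ) (x : K), σ • absEmbedding ℚ K x = absEmbedding ℚ K (r σ x) :=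
    fun σ x ↦ by
    have := AlgEquiv.restrictNormal_commutes (absoluteGaloisGroup.toAlgEquiv ℚ σ) K x
    rw [absoluteGaloisGroup.smul_def]
    exact this.symm
  have hrange : ∀ σ : absoluteGaloisGroup ℚ, r σ = 1 → σ ∈ (absGaloisRestrict ℚ K).range := by
    intro σ hσ
    rw [mem_range_absGaloisRestrict_iff_smul_absEmbedding]
    intro x
    rw [hr, hσ, AlgEquiv.one_apply]
  have hf2 := LocalFrob.inertiaDeg_eq_two_of_isPrime_span K hK.1 hℓp hℓP w hw
  have hrh₀ : r h₀ ≠ 1 := by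
    intro h1
    obtain ⟨τ, hτ⟩ := MonoidHom.mem_range.mp (hrange h₀ h1)
    have hτ' : absGaloisRestrict ℚ K τ = h₀ := hτ
    have hf1 := inertiaDeg_eq_one_of_isArithFrobAt_absGaloisRestrict (F := ℚ) (M := K) hwv₁ h𝔓 (τ := τ)
      (by rw [hτ']; exact hh₀)
    rw [hf2] at hf1
    exact absurd hf1 (by norm_num)
  have hrc₀ : r c₀ ≠ 1 := fun h1 ↦
    Rat.not_mem_range_absGaloisRestrict_of_isComplexConjugation K hK.2 hc₀ (hrange c₀ h1)
  have hcard : Nat.card (K ≃ₐ[ℚ] K) = 2 := by rw [IsGalois.card_aut_eq_finrank, hK.1]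
  obtain ⟨y, -, hy⟩ := (Nat.card_eq_two_iff' (1 : K ≃ₐ[ℚ] K)).mp hcard
  have hrh : r h = y := by
    have hrh0 : r h₀ = y := hy _ hrh₀
    rw [hhdef, map_mul, map_mul, map_inv, hrh0]
    by_cases hrg : r g = 1
    · rw [hrg, one_mul, inv_one, mul_one]
    · rw [hy _ hrg, mul_inv_cancel_right]
  have hmem : c₀⁻¹ * h ∈ (absGaloisRestrict ℚ K).range := by
    refine hrange _ ?_
    rw [map_mul, map_inv, hrh, hy _ hrc₀, inv_mul_cancel]
  obtain ⟨τ, hτ⟩ := MonoidHom.mem_range.mp hmem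
  have hτ' : absGaloisRestrict ℚ K τ = c₀⁻¹ * h := hτ
  refine ⟨v₁, g • 𝔓', h, c₀, hℓv₁, smul_mem_primesAbove h𝔓' g, hhFrob, hc₀, hhP, fun e x ↦ ?_⟩
  have hh' : h = c₀ * absGaloisRestrict ℚ K τ := by rw [hτ', mul_inv_cancel_left]
  rw [hh', mul_smul, absGaloisRestrict_smul_apply_eq τ e x]

/-! ## §3 Frame forms: Gross's `IsKolyvaginPrime` at level 2, the tower hypothesis of L_T, the engine's `ht4` -/

omit [W.IsElliptic] [W.IsGloballyMinimal] in
/-- The tower hypothesis of L_T's frame (`∀ n ≥ 1, ρ_{E,2^n}` onto) at the level `2^M`, in the `ℕ`-cast form used above.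
[folklore] -/
theorem hasSurjectiveModNGaloisRep_two_pow_of_tower {M : ℕ} (hM : 1 ≤ M)
    (hρ : ∀ n : ℕ, 0 < n → W.HasSurjectiveModNGaloisRep ((2 : ℤ) ^ n)) :
    W.HasSurjectiveModNGaloisRep (2 ^ M : ℕ) := by
  have h : ((2 ^ M : ℕ) : ℤ) = (2 : ℤ) ^ M := by push_cast; ring
  rw [h]
  exact hρ M hM

/-- **Gross–Kolyvagin primes at `2` of Zhang index `≥ M` are level-`2^M` Gross primes, frame form**: `Δ < 0`, `K` imaginary
quadratic, the `2`-adic tower onto, `ℓ` with Gross's `IsKolyvaginPrime N_E W K 2 ℓ` ((3.1)–(3.2) at `p = 2`) and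
`M ≤ kolyvaginIndex W 2 ℓ`, `M ≥ 1` ⟹ `FrobEqFrobInfty W K (2^M) ℓ`.  So the (β″) re-typing of L_T's witness `hPn` may be
written in the classical currency «Kolyvagin prime at `2` of index `≥ 2`». [cite: GrossLMS1991, §3 (3.1)–(3.3)]
[cite: WZhang2014, Notations (xii)] -/
theorem frobEqFrobInfty_two_pow_of_isKolyvaginPrime_two (hK : IsImaginaryQuadratic K) (hΔ : W.Δ < 0) {M : ℕ}
    (hM : 1 ≤ M) (hρ : ∀ n : ℕ, 0 < n → W.HasSurjectiveModNGaloisRep ((2 : ℤ) ^ n)) {ℓ : ℕ}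
    (hℓ : IsKolyvaginPrime (W.conductorNorm ℤ) W K 2 ℓ) (hℓM : M ≤ Zhang2014.kolyvaginIndex W 2 ℓ) :
    FrobEqFrobInfty W K (2 ^ M) ℓ :=
  have hZ : Zhang2014.IsKolyvaginPrime (W.conductorNorm ℤ) W K 2 ℓ :=
    ⟨hℓ.1, hℓ.2.1, hℓ.2.2.1, hℓ.2.2.2.1, hℓ.2.2.2.2.1, lt_of_lt_of_le (by omega) hℓM⟩
  frobEqFrobInfty_two_pow_of_frobEqFrobInfty_two W K hK hΔ hM (hasSurjectiveModNGaloisRep_two_pow_of_tower W hM hρ)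
    hZ hℓM hℓ.2.2.2.2.2

/-- **Gross's predicate at level `2^M`** from the level-2 one and the index: `IsKolyvaginPrime N_E W K (2^M) ℓ` (same frame).
[cite: GrossLMS1991, §3 (3.1)–(3.2)] -/
theorem isKolyvaginPrime_two_pow_of_isKolyvaginPrime_two (hK : IsImaginaryQuadratic K) (hΔ : W.Δ < 0) {M : ℕ}
    (hM : 1 ≤ M) (hρ : ∀ n : ℕ, 0 < n → W.HasSurjectiveModNGaloisRep ((2 : ℤ) ^ n)) {ℓ : ℕ}
    (hℓ : IsKolyvaginPrime (W.conductorNorm ℤ) W K 2 ℓ) (hℓM : M ≤ Zhang2014.kolyvaginIndex W 2 ℓ) :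
    IsKolyvaginPrime (W.conductorNorm ℤ) W K (2 ^ M) ℓ := by
  refine ⟨hℓ.1, hℓ.2.1, hℓ.2.2.1, fun h ↦ ?_, hℓ.2.2.2.2.1,
    frobEqFrobInfty_two_pow_of_isKolyvaginPrime_two W K hK hΔ hM hρ hℓ hℓM⟩
  -- `ℓ ≠ 2^M`: `ℓ` is an odd prime
  have h2ℓ : 2 ∣ ℓ := by rw [h]; exact dvd_pow_self 2 (by omega)
  exact hℓ.2.2.2.1 ((Nat.prime_dvd_prime_iff_eq Nat.prime_two hℓ.1).mp h2ℓ).symm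

/-- **The bottom-rung engine's hypothesis `ht4` from its `hTK`** (`…RTBottomRungEngine*`: at the witness primes the engine
asks `FrobEqFrobInfty W K (2^2) ℓ` on top of `FrobEqFrobInfty W K 2 ℓ ∧ 2 ≤ kolyvaginIndex W 2 ℓ ∧ Zhang2014.IsKolyvaginPrime`):
on `Δ < 0` with the tower onto, the former FOLLOWS from the latter. [cite: GrossLMS1991, §3 (3.2)–(3.3)]
[cite: McCallumLMS1991, §4 (p. 299)] -/
theorem frobEqFrobInfty_four_of_frobEqFrobInfty_two (hK : IsImaginaryQuadratic K) (hΔ : W.Δ < 0)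
    (hρ : ∀ n : ℕ, 0 < n → W.HasSurjectiveModNGaloisRep ((2 : ℤ) ^ n)) {ℓ : ℕ}
    (hℓ : Zhang2014.IsKolyvaginPrime (W.conductorNorm ℤ) W K 2 ℓ) (h2 : 2 ≤ Zhang2014.kolyvaginIndex W 2 ℓ)
    (hG : FrobEqFrobInfty W K 2 ℓ) : FrobEqFrobInfty W K (2 ^ 2) ℓ :=
  frobEqFrobInfty_two_pow_of_frobEqFrobInfty_two W K hK hΔ (by norm_num)
    (hasSurjectiveModNGaloisRep_two_pow_of_tower W (by norm_num) hρ) hℓ h2 hG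

end Summit.BirchSwinnertonDyer.BirchSwinnertonDyer.Theorems.GenusExact.GrossLevelAtTwo

end
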